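import Literature.AlgebraicGeometry.AbelianSchemes.IsLambdaOfAtAlongIsogeny
import Literature.AlgebraicGeometry.AbelianSchemes.AbelianSchemeDualIsogeny
import HarnessLib

/-!
# `Λ(ψ^*𝒪(Θ_B)) = ψ^∨ ∘ Λ(𝒪(Θ_B)) ∘ ψ` and `D_Q(ψ^*Θ_B) ∼ ν · D_Q(Θ′)` for THE dual isogeny `ψ^∨` of the tree

Layer `Literature/AlgebraicGeometry/AbelianSchemes`, namespace `Literature.AlgebraicGeometry.AbelianSchemes.AbelianSchemeOver`.
THEOREMS ONLY (no definition, no named fact, no instance, no `sorry`).  Cell `hodgecm-mathlib` (D-0151), HECKE-LINK: the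
ONE-TIME ADAPTER (B-plan1 (g14) GO 21:27Z) plugging the tree's dual morphism ★ `DualPair.dualIsogeny ψ D′ DB = ψ^∨`
(`AbelianSchemeDualIsogeny`, [MilneAV2008] I §8: the classifying morphism of `(ψ × 1)^*𝒫_B`) into the «map as a variable»
engine ★ `IsLambdaOfAtAlongIsogeny`: its Poincaré clause (e1) `(ψ × 1)^*𝒫_B ≅ (1 × ψ^∨)^*𝒫′` (★
`nonempty_pullbackP_dualIsogeny_iso`) IS the `(mψ, mψd, eP)` triple with `mψ := (baseChangeHom ψ π_{B̂}).left` (★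
`RigidifiedLineBundleComapHom`) and `mψd := 1_{A′} × ψ^∨` (★ `baseChangeToProd`), whose four projection equations are ★ /
one line.  HC_CM is proved only modulo the 7 printed citations until rung 0 closes.

* `baseChangeHom_left_comp_snd` — the missing projection equation of `ψ × 1`;
* `DualPair.poincareClause_dualIsogeny` — (e1) in the engine's orientation;
* **`IsLambdaOfAt.pullback_dualIsogeny`** — `λ̄_B = Λ(𝒪(Θ_B))` at `s` ⟹ `ψ ≫ λ_B ≫ ψ^∨` is `Λ(𝒪(ψ_s^*Θ_B))` at `s`
  ([MumfordAV1970] §23; [MumfordFogartyKirwan1994] (6.3) «`Λ(ψ^*L) = ψ̂ Λ(L) ψ`»);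
* **`weilDiv_pullback_fibreHom_linEquiv_nsmul_dualIsogeny`** — under `ψ ≫ λ_B ≫ ψ^∨ = λ′^ν` (export (b)), witnesses `Θ′`,
  `Θ_B` give `D_Q(ψ_s^*Θ_B) ∼ ν · D_Q(Θ′)` for every `Ω`-point `Q` of `A′_s` — the `hφ`/`hW` clause with NO plumbing binders
  (+ the primed form with `λ′ ≫ [ν]`).

## References
* [MumfordAV1970] D. Mumford, *Abelian Varieties* (1970), §15 Thm. 1 (p. 143), §23 (Thm. 2, p. 231).
* [MilneAV2008] J. S. Milne, *Abelian Varieties* (v2.00, 2008), I §8 pp. 36–37.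
* [MumfordFogartyKirwan1994] D. Mumford, J. Fogarty, F. Kirwan, *Geometric Invariant Theory* (3rd ed., 1994), Ch. 6 §2
  Definition 6.2–6.3 (p. 120) and (6.3) (p. 121).
-/

noncomputable section

open CategoryTheory CategoryTheory.Limits AlgebraicGeometry MonoidalCategory

universe u

namespace Literature.AlgebraicGeometry.AbelianSchemes

open Literature.AlgebraicGeometry.Motives Literature.AlgebraicGeometry.AbelianVarieties
open scoped MonObj

namespace AbelianSchemeOver

variable {S : Scheme.{u}} {A' B : AbelianSchemeOver S} (ψ : A'.X ⟶ B.X) [IsMonHom ψ] (D' : A'.DualPair) (DB : B.DualPair)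

omit [IsMonHom ψ] in
/-- **`(ψ × 1) ≫ pr₂ = pr₂`** for the base change `ψ × 1 : A′ ×_S T → B ×_S T` of a homomorphism (Mathlib
`Over.pullback_map_left`; companion of ★ `baseChangeHom_left_comp_fst`). [cite: MilneAV2008, I §8 pp. 36–37] -/
theorem baseChangeHom_left_comp_snd {T : Scheme.{u}} (f : T ⟶ S) :
    (baseChangeHom ψ f).left ≫ pullback.snd B.X.hom f = pullback.snd A'.X.hom f :=
  (congrArg (fun x => x ≫ pullback.snd B.X.hom f) (Over.pullback_map_left f A'.X (k := ψ))).trans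
    (pullback.lift_snd _ _ _)

/-- **(e1) for `ψ^∨`, in the engine's orientation**: `(ψ × 1)^*𝒫_B ≅ (1 × ψ^∨)^*𝒫′` on `A′ ×_S B̂`
(★ `nonempty_pullbackP_dualIsogeny_iso`, ★ `pullbackP` unfolded). [cite: MilneAV2008, I §8 pp. 36–37]
[cite: MumfordAV1970, §15 Thm. 1 (p. 143)] -/
theorem DualPair.poincareClause_dualIsogeny :
    Nonempty ((Scheme.Modules.pullback (baseChangeHom ψ DB.hat.X.hom).left).obj DB.P ≅
      (Scheme.Modules.pullback (A'.baseChangeToProd D'.hat DB.hat.X.hom (DualPair.dualIsogeny ψ D' DB)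
        (DualPair.dualIsogeny_comp_hom ψ D' DB))).obj D'.P) :=
  (DualPair.nonempty_pullbackP_dualIsogeny_iso ψ D' DB).map Iso.symm

variable {Ω : Type u} [Field Ω] (s : Spec (.of Ω) ⟶ S) [IsDominant (AbelianVariety.Hom.toSchemeHom (fibreHom ψ s))]
  (lamB : B.X ⟶ DB.hat.X)

/-- **`λ̄_B = Λ(𝒪(Θ_B))` at `s` ⟹ `ψ ≫ λ_B ≫ ψ^∨` is `Λ(𝒪(ψ_s^*Θ_B))` at `s`**, `ψ^∨ = DualPair.dualIsogenyOver ψ D′ DB`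
(★ `IsLambdaOfAt.pullback_isogeny` at the tree's dual morphism). [cite: MumfordAV1970, §23 (Thm. 2, p. 231)]
[cite: MumfordFogartyKirwan1994, Ch. 6 §2 Definition 6.2–6.3 (p. 120)] -/
theorem IsLambdaOfAt.pullback_dualIsogeny (ΘB : CartierDivisor (B.fibre s).toAbelianVariety.X.left)
    (hB : B.IsLambdaOfAt s DB lamB ΘB) :
    A'.IsLambdaOfAt s D' (ψ ≫ lamB ≫ DualPair.dualIsogenyOver ψ D' DB)
      (ΘB.pullback (AbelianVariety.Hom.toSchemeHom (fibreHom ψ s))) := by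
  obtain ⟨eP⟩ := DualPair.poincareClause_dualIsogeny ψ D' DB
  exact IsLambdaOfAt.pullback_isogeny s A' B ψ D' DB lamB (DualPair.dualIsogenyOver ψ D' DB)
    (baseChangeHom ψ DB.hat.X.hom).left (baseChangeHom_left_comp_fst ψ DB.hat.X.hom)
    (baseChangeHom_left_comp_snd ψ DB.hat.X.hom)
    (A'.baseChangeToProd D'.hat DB.hat.X.hom (DualPair.dualIsogeny ψ D' DB) (DualPair.dualIsogeny_comp_hom ψ D' DB))
    (A'.baseChangeToProd_fst D'.hat _ _ _) (A'.baseChangeToProd_snd D'.hat _ _ _) eP ΘB hB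

/-- **THE `hφ`/`hW` CLAUSE FOR `ψ^∨`, binder-free**: if `ψ ≫ λ_B ≫ ψ^∨ = λ′^ν` (export (b)) and `Θ′`, `Θ_B` witness `λ̄′`,
`λ̄_B` at `s`, then `D_Q(ψ_s^*Θ_B) ∼ ν · D_Q(Θ′)` for every `Ω`-point `Q` of `A′_s` (★ `weilDiv_pullback_fibreHom_linEquiv_nsmul`).
[cite: MumfordAV1970, §23 (Thm. 2, p. 231)] [cite: MumfordFogartyKirwan1994, Ch. 6 §2 (6.3) (p. 121)] -/
theorem weilDiv_pullback_fibreHom_linEquiv_nsmul_dualIsogeny {lam' : A'.X ⟶ D'.hat.X} [IsMonHom lam'] {ν : ℕ}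
    (hb : ψ ≫ lamB ≫ DualPair.dualIsogenyOver ψ D' DB = lam' ^ ν)
    {Θ' : CartierDivisor (A'.fibre s).toAbelianVariety.X.left} (hΘ' : A'.IsLambdaOfAt s D' lam' Θ')
    {ΘB : CartierDivisor (B.fibre s).toAbelianVariety.X.left} (hΘB : B.IsLambdaOfAt s DB lamB ΘB)
    (Q : (A'.fibre s).toAbelianVariety.Points Ω) :
    ((A'.fibre s).toAbelianVariety.weilDiv (ΘB.pullback (AbelianVariety.Hom.toSchemeHom (fibreHom ψ s))) Q).LinEquiv
      (ν • (A'.fibre s).toAbelianVariety.weilDiv Θ' Q) := by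
  obtain ⟨eP⟩ := DualPair.poincareClause_dualIsogeny ψ D' DB
  exact A'.weilDiv_pullback_fibreHom_linEquiv_nsmul s B ψ D' DB lamB (DualPair.dualIsogenyOver ψ D' DB)
    (baseChangeHom ψ DB.hat.X.hom).left (baseChangeHom_left_comp_fst ψ DB.hat.X.hom)
    (baseChangeHom_left_comp_snd ψ DB.hat.X.hom)
    (A'.baseChangeToProd D'.hat DB.hat.X.hom (DualPair.dualIsogeny ψ D' DB) (DualPair.dualIsogeny_comp_hom ψ D' DB))
    (A'.baseChangeToProd_fst D'.hat _ _ _) (A'.baseChangeToProd_snd D'.hat _ _ _) eP hb hΘ' hΘB Q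

/-- The same with (b) spelled `ψ ≫ λ_B ≫ ψ^∨ = λ′ ≫ [ν]_{Â′}` (`[ν] = (𝟙 Â′)^ν = D′.hat.mulN ν`).
[cite: MumfordAV1970, §23 (Thm. 2, p. 231)] [cite: MumfordFogartyKirwan1994, Ch. 6 §2 (6.3) (p. 121)] -/
theorem weilDiv_pullback_fibreHom_linEquiv_nsmul_dualIsogeny' {lam' : A'.X ⟶ D'.hat.X} [IsMonHom lam'] {ν : ℕ}
    (hb : ψ ≫ lamB ≫ DualPair.dualIsogenyOver ψ D' DB = lam' ≫ (𝟙 D'.hat.X) ^ ν)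
    {Θ' : CartierDivisor (A'.fibre s).toAbelianVariety.X.left} (hΘ' : A'.IsLambdaOfAt s D' lam' Θ')
    {ΘB : CartierDivisor (B.fibre s).toAbelianVariety.X.left} (hΘB : B.IsLambdaOfAt s DB lamB ΘB)
    (Q : (A'.fibre s).toAbelianVariety.Points Ω) :
    ((A'.fibre s).toAbelianVariety.weilDiv (ΘB.pullback (AbelianVariety.Hom.toSchemeHom (fibreHom ψ s))) Q).LinEquiv
      (ν • (A'.fibre s).toAbelianVariety.weilDiv Θ' Q) := by
  rw [MonObj.comp_pow, Category.comp_id] at hb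
  exact weilDiv_pullback_fibreHom_linEquiv_nsmul_dualIsogeny ψ D' DB s lamB hb hΘ' hΘB Q

end AbelianSchemeOver

end Literature.AlgebraicGeometry.AbelianSchemes
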